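import Literature.MathematicalPhysics.KineticTheory.SiteChainReversal
import Literature.MathematicalPhysics.KineticTheory.SiteChainFokkerPlanckProfiles
import Literature.Analysis.Distribution.FieldIntegrationByParts
import HarnessLib

/-!
# Fokker–Planck identification for site-inhomogeneous chains, I: integration by parts

Topic `Literature/MathematicalPhysics/KineticTheory`, grouping namespace `…KineticTheory.HeatConduction`.
For a site-dependent chain `P : SiteChain` (`CellChain.lean`) with `C²` potentials and `N ≥ 1`,
the Lebesgue transpose of the Langevin generator `L = Y·∇ + ½∑_b D²[v_b,v_b]`
(`sdeGenerator (P.langevinDrift N) v_L v_R = P.generator N T_L T_R` on `C²`,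
`SiteChainLangevinKernel.lean`) is `Lᵀ = L̂ + 2γ`, where `L̂ = sdeGenerator (-Y) v_L v_R` is the
generator of the time-reversed equation (`div Y = -2γ`, `SiteChainReversal.lean`):

* `integral_fderiv_fderiv_mul_eq_of_contDiff` — `∫ D²f[v,v] g = ∫ f D²g[v,v]` on a
  finite-dimensional space with an additive Haar measure (two integrations by parts along a
  constant field);
* `SiteChain.integral_sdeGenerator_mul_eq` — **`∫ (L f) g dx = ∫ f (L̂ g + 2γ g) dx`** for
  `f ∈ C²_c`, `g ∈ C²`;
* `SiteChain.revGenerator_add_eq_zero_of_weak` — a `C²` function `ρ` that is weakly stationary,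
  `∫ (L φ) ρ dx = 0` for all `φ ∈ C_c^∞`, solves the stationary Fokker–Planck equation POINTWISE:
  `L̂ ρ + 2γ ρ = 0`;
* `SiteChain.integral_generator_mul_comp_eq` — the entropy-type identity
  `∫ (L a) F(ρ) dx = ∫ a (½ F''(ρ) Γ(ρ,ρ) - 2γ (ρ F'(ρ) - F(ρ))) dx` for such `ρ`, a compactly
  supported `C²` weight `a` and a `C²` profile `F`, and the resulting **weighted Fisher-information
  bound** `SiteChain.half_integral_weightedFisher_le`:
  `½ ∫ a F''(ρ) Γ(ρ,ρ) ≤ ℓ (K + 2γ) ∫ θ(ρ)` when `a ≤ 1`, `|L a| ≤ K`, `0 ≤ F, sF' - F ≤ ℓ θ`.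

Twin of the `OscillatorChain` file `Summits/…/EmbeddedDrudeMourreNessUniqueIBP.lean` for
site-dependent data (Cuneo–Eckmann–Hairer–Rey-Bellet 2018 §3.1: `L*` is the formal adjoint of the
generator); `C²` potentials suffice throughout.

## References

* N. Cuneo, J.-P. Eckmann, M. Hairer, L. Rey-Bellet, Electron. J. Probab. **23** (2018) no. 55, §3.1.
* D. Bakry, I. Gentil, M. Ledoux, *Analysis and Geometry of Markov Diffusion Operators* (2014), §1.4.2.
-/

noncomputable section

open MeasureTheory Filter Topology Set
open scoped ContDiff NNReal ENNReal

namespace Literature.MathematicalPhysics.KineticTheory.HeatConduction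

open Literature.MathematicalPhysics.KineticTheory Literature.Analysis.Distribution

/-! ### Second derivatives along a constant vector field -/

section ConstField

variable {E : Type*} [NormedAddCommGroup E] [NormedSpace ℝ E]

/-- `D²f(x)[v, v] = X(Xf)(x)` for the constant field `X ≡ v` and `f ∈ C²` (any normed space).
[folklore] -/
theorem fderiv_fderiv_apply_eq_fieldDeriv_const {f : E → ℝ} (hf : ContDiff ℝ 2 f) (v x : E) :
    fderiv ℝ (fderiv ℝ f) x v v = fieldDeriv (fun _ => v) (fieldDeriv (fun _ => v) f) x := by
  have hd : DifferentiableAt ℝ (fderiv ℝ f) x :=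
    ((hf.fderiv_right (m := 1) (by norm_num)).differentiable (by norm_num)) x
  have e : fieldDeriv (fun _ => v) f = fun y => (fderiv ℝ f y) v := by
    funext y; rfl
  rw [fieldDeriv_apply, e, fderiv_clm_apply hd (differentiableAt_const v)]
  simp

/-- `y ↦ Df(y)·v` is `C¹` for `f ∈ C²` (any normed space). [folklore] -/
theorem contDiff_one_fieldDeriv_constField {f : E → ℝ} (hf : ContDiff ℝ 2 f) (v : E) :
    ContDiff ℝ 1 (fieldDeriv (fun _ => v) f) := by
  have e : fieldDeriv (fun _ => v) f = fun y => (fderiv ℝ f y) v := by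
    funext y; rfl
  rw [e]
  exact (hf.fderiv_right (m := 1) (by norm_num)).clm_apply contDiff_const

variable [FiniteDimensional ℝ E] [MeasurableSpace E] [BorelSpace E] {μ : Measure E} [μ.IsAddHaarMeasure]

/-- Integration by parts twice along a constant field, on a finite-dimensional space with an
additive Haar measure: `∫ D²f[v,v] g dμ = ∫ f D²g[v,v] dμ` for `f ∈ C²_c`, `g ∈ C²`. [folklore] -/
theorem integral_fderiv_fderiv_mul_eq_of_contDiff {f g : E → ℝ} (hf : ContDiff ℝ 2 f) (hg : ContDiff ℝ 2 g)
    (hfc : HasCompactSupport f) (v : E) :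
    ∫ x, fderiv ℝ (fderiv ℝ f) x v v * g x ∂μ = ∫ x, f x * fderiv ℝ (fderiv ℝ g) x v v ∂μ := by
  have hX : ContDiff ℝ 1 (fun _ : E => v) := contDiff_const
  have hf1 : ContDiff ℝ 1 f := hf.of_le (by norm_num)
  have hg1 : ContDiff ℝ 1 g := hg.of_le (by norm_num)
  have htr : ∀ (h : E → ℝ) (x : E), fieldTranspose (fun _ => v) h x = -(fieldDeriv (fun _ => v) h x) := by
    intro h x
    simp [fieldTranspose, fieldDiv, fieldDeriv]
  simp_rw [fderiv_fderiv_apply_eq_fieldDeriv_const hf, fderiv_fderiv_apply_eq_fieldDeriv_const hg]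
  rw [integral_fieldDeriv_mul (μ := μ) hX (contDiff_one_fieldDeriv_constField hf v) hg1
    (hasCompactSupport_fieldDeriv _ hfc)]
  have e1 : (fun x => fieldDeriv (fun _ => v) f x * fieldTranspose (fun _ => v) g x) =
      fun x => -(fieldDeriv (fun _ => v) f x * fieldDeriv (fun _ => v) g x) := by
    funext x
    rw [htr]
    ring
  rw [e1, integral_neg, integral_fieldDeriv_mul (μ := μ) hX hf1 (contDiff_one_fieldDeriv_constField hg v) hfc]
  have e2 : (fun x => f x * fieldTranspose (fun _ => v) (fieldDeriv (fun _ => v) g) x) =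
      fun x => -(f x * fieldDeriv (fun _ => v) (fieldDeriv (fun _ => v) g) x) := by
    funext x
    rw [htr]
    ring
  rw [e2, integral_neg, neg_neg]

end ConstField

/-! ### `∫ (L f) g = ∫ f (L̂ g + 2γ g)` -/

variable {N : ℕ}

namespace SiteChain

variable (P : SiteChain)

/-- The divergence of the Langevin drift of a site-dependent chain, `div Y = -2γ` (`N ≥ 1`, `C²`
potentials), in the `fieldDiv` notation of the integration-by-parts library. [folklore] -/
theorem fieldDiv_langevinDrift_U2 (hU : ∀ i, ContDiff ℝ 2 (P.U i)) (hV : ∀ i, ContDiff ℝ 2 (P.V i))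
    (hN : 0 < N) (x : PhaseSpace N) : fieldDiv (P.langevinDrift N) x = -(2 * P.γ) :=
  P.trace_fderiv_langevinDrift_U2 hU hV hN x

/-- **The Lebesgue transpose of the Langevin generator of a site-dependent chain is `L̂ + 2γ`**:
for `C²` potentials, `N ≥ 1`, `f ∈ C²_c` and `g ∈ C²`,
`∫ (L f) g dx = ∫ f (L̂ g + 2γ g) dx`, `L = sdeGenerator Y v_L v_R`, `L̂ = sdeGenerator (-Y) v_L v_R`
(`div Y = -2γ`; the second-order part is symmetric). [cite: CuneoEckmannHairerReyBellet2018, §3.1] -/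
theorem integral_sdeGenerator_mul_eq (hU : ∀ i, ContDiff ℝ 2 (P.U i)) (hV : ∀ i, ContDiff ℝ 2 (P.V i))
    (hN : 0 < N) (T_L T_R : ℝ) {f g : PhaseSpace N → ℝ} (hf : ContDiff ℝ 2 f) (hg : ContDiff ℝ 2 g)
    (hfc : HasCompactSupport f) :
    ∫ x, sdeGenerator (P.langevinDrift N) (P.noiseVecL N T_L) (P.noiseVecR N T_R) f x * g x =
      ∫ x, f x * (sdeGenerator (fun y => -P.langevinDrift N y) (P.noiseVecL N T_L) (P.noiseVecR N T_R) g x +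
        2 * P.γ * g x) := by
  haveI : (volume : Measure (PhaseSpace N)).IsAddHaarMeasure := Measure.prod.instIsAddHaarMeasure _ _
  set vL := P.noiseVecL N T_L
  set vR := P.noiseVecR N T_R
  have hY : ContDiff ℝ 1 (P.langevinDrift N) := P.contDiff_one_langevinDrift hU hV N
  have hYc : Continuous (P.langevinDrift N) := hY.continuous
  have hf1 : ContDiff ℝ 1 f := hf.of_le (by norm_num)
  have hg1 : ContDiff ℝ 1 g := hg.of_le (by norm_num)
  have hg1c : Continuous (fderiv ℝ g) := hg.continuous_fderiv (by norm_num)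
  -- first-order part
  have h1 : ∫ x, fderiv ℝ f x (P.langevinDrift N x) * g x =
      ∫ x, f x * (fderiv ℝ g x (-P.langevinDrift N x) + 2 * P.γ * g x) := by
    have h := integral_fieldDeriv_mul (μ := volume) hY hf1 hg1 hfc
    simp only [fieldDeriv_apply] at h
    rw [h]
    refine integral_congr_ae (Eventually.of_forall fun x => ?_)
    simp only [fieldTranspose, fieldDeriv_apply, P.fieldDiv_langevinDrift_U2 hU hV hN, map_neg]
    ring
  -- second-order parts
  have h2 : ∀ v : PhaseSpace N, ∫ x, fderiv ℝ (fderiv ℝ f) x v v * g x =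
      ∫ x, f x * fderiv ℝ (fderiv ℝ g) x v v := fun v =>
    integral_fderiv_fderiv_mul_eq_of_contDiff (μ := volume) hf hg hfc v
  -- continuity and compact support of the pieces
  have cB : ∀ (h : PhaseSpace N → ℝ), ContDiff ℝ 2 h → ∀ v : PhaseSpace N,
      Continuous fun x => fderiv ℝ (fderiv ℝ h) x v v := fun h hh v =>
    ((((hh.fderiv_right (m := 1) (by norm_num)).continuous_fderiv (by norm_num)).clm_apply
      continuous_const).clm_apply continuous_const)
  have sB : ∀ v : PhaseSpace N, HasCompactSupport fun x => fderiv ℝ (fderiv ℝ f) x v v := fun v => by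
    have e : (fun x => fderiv ℝ (fderiv ℝ f) x v v) =
        fieldDeriv (fun _ => v) (fieldDeriv (fun _ => v) f) := funext fun x =>
      fderiv_fderiv_apply_eq_fieldDeriv_const hf v x
    rw [e]
    exact hasCompactSupport_fieldDeriv _ (hasCompactSupport_fieldDeriv _ hfc)
  have iA : Integrable (fun x => fderiv ℝ f x (P.langevinDrift N x) * g x) :=
    ((continuous_fieldDeriv hYc hf1).mul hg.continuous).integrable_of_hasCompactSupport
      ((hasCompactSupport_fieldDeriv (P.langevinDrift N) hfc).mul_right)
  have iB : ∀ v : PhaseSpace N, Integrable (fun x => fderiv ℝ (fderiv ℝ f) x v v * g x) := fun v =>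
    ((cB f hf v).mul hg.continuous).integrable_of_hasCompactSupport ((sB v).mul_right)
  have iA' : Integrable (fun x => f x * (fderiv ℝ g x (-P.langevinDrift N x) + 2 * P.γ * g x)) :=
    (hf.continuous.mul ((hg1c.clm_apply hYc.neg).add (continuous_const.mul hg.continuous))).integrable_of_hasCompactSupport
      hfc.mul_right
  have iB' : ∀ v : PhaseSpace N, Integrable (fun x => f x * fderiv ℝ (fderiv ℝ g) x v v) := fun v =>
    (hf.continuous.mul (cB g hg v)).integrable_of_hasCompactSupport hfc.mul_right
  -- expand both sides
  have eL : (fun x => sdeGenerator (P.langevinDrift N) vL vR f x * g x) = fun x =>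
      fderiv ℝ f x (P.langevinDrift N x) * g x +
        (1 / 2) * (fderiv ℝ (fderiv ℝ f) x vL vL * g x + fderiv ℝ (fderiv ℝ f) x vR vR * g x) := by
    funext x; rw [sdeGenerator_def]; ring
  have eR : (fun x => f x * (sdeGenerator (fun y => -P.langevinDrift N y) vL vR g x + 2 * P.γ * g x)) = fun x =>
      f x * (fderiv ℝ g x (-P.langevinDrift N x) + 2 * P.γ * g x) +
        (1 / 2) * (f x * fderiv ℝ (fderiv ℝ g) x vL vL + f x * fderiv ℝ (fderiv ℝ g) x vR vR) := by
    funext x; rw [sdeGenerator_def]; ring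
  have iS : Integrable (fun x => (1 : ℝ) / 2 *
      (fderiv ℝ (fderiv ℝ f) x vL vL * g x + fderiv ℝ (fderiv ℝ f) x vR vR * g x)) := by
    exact ((iB vL).add (iB vR)).const_mul _
  have iS' : Integrable (fun x => (1 : ℝ) / 2 *
      (f x * fderiv ℝ (fderiv ℝ g) x vL vL + f x * fderiv ℝ (fderiv ℝ g) x vR vR)) := by
    exact ((iB' vL).add (iB' vR)).const_mul _
  rw [eL, eR, integral_add iA iS, integral_add iA' iS', integral_const_mul, integral_const_mul,
    integral_add (iB vL) (iB vR), integral_add (iB' vL) (iB' vR), h1, h2 vL, h2 vR]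

/-! ### Weak stationarity of a `C²` density is the pointwise stationary Fokker–Planck equation -/

/-- `L̂ g + 2γ g` is continuous for `g ∈ C²` and `C²` potentials. [folklore] -/
theorem continuous_revGenerator_add (hU : ∀ i, ContDiff ℝ 2 (P.U i)) (hV : ∀ i, ContDiff ℝ 2 (P.V i))
    (T_L T_R : ℝ) {g : PhaseSpace N → ℝ} (hg : ContDiff ℝ 2 g) :
    Continuous fun x => sdeGenerator (fun y => -P.langevinDrift N y) (P.noiseVecL N T_L) (P.noiseVecR N T_R) g x +
      2 * P.γ * g x :=
  (continuous_sdeGenerator _ _ (P.contDiff_one_langevinDrift hU hV N).continuous.neg hg).add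
    (continuous_const.mul hg.continuous)

/-- **A weakly stationary `C²` density solves `L̂ ρ + 2γ ρ = 0` pointwise** (site-dependent
chain). If `ρ ∈ C²` and `∫ (L φ) ρ dx = 0` for every `φ ∈ C_c^∞` (`L = P.generator N T_L T_R`, `C²`
potentials, `N ≥ 1`, `γT_L, γT_R ≥ 0`), then `L̂ ρ(x) + 2γ ρ(x) = 0` for every `x`: by
`integral_sdeGenerator_mul_eq` the continuous function `L̂ρ + 2γρ` is orthogonal to all test
functions. [cite: CuneoEckmannHairerReyBellet2018, §3.1] -/
theorem revGenerator_add_eq_zero_of_weak (hU : ∀ i, ContDiff ℝ 2 (P.U i)) (hV : ∀ i, ContDiff ℝ 2 (P.V i))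
    (hN : 0 < N) {T_L T_R : ℝ} (hL : 0 ≤ P.γ * T_L) (hR : 0 ≤ P.γ * T_R) {ρ : PhaseSpace N → ℝ}
    (hρ : ContDiff ℝ 2 ρ)
    (hweak : ∀ φ : PhaseSpace N → ℝ, ContDiff ℝ ∞ φ → HasCompactSupport φ →
      ∫ x, P.generator N T_L T_R φ x * ρ x = 0) (x : PhaseSpace N) :
    sdeGenerator (fun y => -P.langevinDrift N y) (P.noiseVecL N T_L) (P.noiseVecR N T_R) ρ x +
      2 * P.γ * ρ x = 0 := by
  haveI : (volume : Measure (PhaseSpace N)).IsAddHaarMeasure := Measure.prod.instIsAddHaarMeasure _ _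
  set w : PhaseSpace N → ℝ := fun x =>
    sdeGenerator (fun y => -P.langevinDrift N y) (P.noiseVecL N T_L) (P.noiseVecR N T_R) ρ x + 2 * P.γ * ρ x
    with hw
  have hwc : Continuous w := P.continuous_revGenerator_add hU hV T_L T_R hρ
  have horth : ∀ φ : PhaseSpace N → ℝ, ContDiff ℝ ∞ φ → HasCompactSupport φ →
      ∫ x, φ x • w x = 0 := by
    intro φ hφ hφc
    have hφ2 : ContDiff ℝ 2 φ := hφ.of_le (by norm_cast)
    have h := P.integral_sdeGenerator_mul_eq hU hV hN T_L T_R hφ2 hρ hφc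
    rw [P.sdeGenerator_langevinDrift_eq_generator hN hL hR hφ2] at h
    rw [← hweak φ hφ hφc, h]
    rfl
  have hae : ∀ᵐ x ∂(volume : Measure (PhaseSpace N)), w x = 0 :=
    ae_eq_zero_of_integral_contDiff_smul_eq_zero (hwc.locallyIntegrable) horth
  have hzero : w = 0 := (hwc.ae_eq_iff_eq (μ := volume) continuous_const).1 hae
  exact congrFun hzero x

/-! ### The entropy-type identity and the weighted Fisher-information bound -/

/-- **The entropy-type identity behind the Fisher-information bound** (site-dependent chain).
For `C²` potentials, `N ≥ 1`, a `C²` solution `ρ` of `L̂ρ + 2γρ = 0`, a compactly supported `C²`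
weight `a` and `F : ℝ → ℝ` with derivatives `F'`, `F''` (`F''` continuous):
`∫ (L a) F(ρ) dx = ∫ a (½ F''(ρ) Γ(ρ,ρ) - 2γ (ρ F'(ρ) - F(ρ))) dx`. [folklore] -/
theorem integral_generator_mul_comp_eq (hU : ∀ i, ContDiff ℝ 2 (P.U i)) (hV : ∀ i, ContDiff ℝ 2 (P.V i))
    (hN : 0 < N) (T_L T_R : ℝ) {ρ : PhaseSpace N → ℝ} (hρ : ContDiff ℝ 2 ρ)
    (hpde : ∀ x, sdeGenerator (fun y => -P.langevinDrift N y) (P.noiseVecL N T_L) (P.noiseVecR N T_R) ρ x +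
      2 * P.γ * ρ x = 0)
    {F F' F'' : ℝ → ℝ} (hF : ∀ u, HasDerivAt F (F' u) u) (hF' : ∀ u, HasDerivAt F' (F'' u) u)
    (hF'' : Continuous F'') {a : PhaseSpace N → ℝ} (ha : ContDiff ℝ 2 a) (hac : HasCompactSupport a) :
    ∫ x, sdeGenerator (P.langevinDrift N) (P.noiseVecL N T_L) (P.noiseVecR N T_R) a x * F (ρ x) =
      ∫ x, a x * ((1 / 2) * F'' (ρ x) *
          carreDuChamp (P.noiseVecL N T_L) (P.noiseVecR N T_R) ρ ρ x -
        2 * P.γ * (ρ x * F' (ρ x) - F (ρ x))) := by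
  have hFρ : ContDiff ℝ 2 fun x => F (ρ x) := contDiff_two_comp_of_hasDerivAt hF hF' hF'' hρ
  rw [P.integral_sdeGenerator_mul_eq hU hV hN T_L T_R ha hFρ hac]
  refine integral_congr_ae (Eventually.of_forall fun x => ?_)
  show a x * (sdeGenerator (fun y => -P.langevinDrift N y) (P.noiseVecL N T_L) (P.noiseVecR N T_R)
      (fun y => F (ρ y)) x + 2 * P.γ * F (ρ x)) = _
  rw [sdeGenerator_comp_eq (fun y => -P.langevinDrift N y) _ _ hF hF' hρ x]
  have h := hpde x
  have e : sdeGenerator (fun y => -P.langevinDrift N y) (P.noiseVecL N T_L) (P.noiseVecR N T_R) ρ x =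
      -(2 * P.γ * ρ x) := by linarith
  rw [e]
  ring

/-- **The weighted Fisher-information bound** (site-dependent chain). In the setting of
`integral_generator_mul_comp_eq`, assume moreover `a ≤ 1`, `|L a| ≤ K`, `ρ ≥ 0`, `γ ≥ 0`, and that
on `s ≥ 0` the convex profile satisfies `0 ≤ F(s) ≤ ℓ θ(s)` and `0 ≤ s F'(s) - F(s) ≤ ℓ θ(s)` with
`θ(ρ)` integrable. Then `½ ∫ a F''(ρ) Γ(ρ,ρ) dx ≤ ℓ (K + 2γ) ∫ θ(ρ) dx`. [folklore] -/
theorem half_integral_weightedFisher_le (hU : ∀ i, ContDiff ℝ 2 (P.U i)) (hV : ∀ i, ContDiff ℝ 2 (P.V i))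
    (hN : 0 < N) (hγ : 0 ≤ P.γ) (T_L T_R : ℝ) {ρ : PhaseSpace N → ℝ} (hρ : ContDiff ℝ 2 ρ)
    (hρ0 : ∀ x, 0 ≤ ρ x)
    (hpde : ∀ x, sdeGenerator (fun y => -P.langevinDrift N y) (P.noiseVecL N T_L) (P.noiseVecR N T_R) ρ x +
      2 * P.γ * ρ x = 0)
    {F F' F'' : ℝ → ℝ} (hF : ∀ u, HasDerivAt F (F' u) u) (hF' : ∀ u, HasDerivAt F' (F'' u) u)
    (hF'' : Continuous F'') {θ : ℝ → ℝ} {ℓ : ℝ}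
    (hF0 : ∀ s, 0 ≤ s → 0 ≤ F s) (hFθ : ∀ s, 0 ≤ s → F s ≤ ℓ * θ s)
    (hG0 : ∀ s, 0 ≤ s → 0 ≤ s * F' s - F s) (hGθ : ∀ s, 0 ≤ s → s * F' s - F s ≤ ℓ * θ s)
    (hθint : Integrable fun x => θ (ρ x))
    {a : PhaseSpace N → ℝ} (ha : ContDiff ℝ 2 a) (hac : HasCompactSupport a)
    (ha1 : ∀ x, a x ≤ 1) {K : ℝ}
    (hK : ∀ x, |sdeGenerator (P.langevinDrift N) (P.noiseVecL N T_L) (P.noiseVecR N T_R) a x| ≤ K) :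
    (1 / 2) * ∫ x, a x * (F'' (ρ x) * carreDuChamp (P.noiseVecL N T_L) (P.noiseVecR N T_R) ρ ρ x) ≤
      ℓ * (K + 2 * P.γ) * ∫ x, θ (ρ x) := by
  set vL := P.noiseVecL N T_L
  set vR := P.noiseVecR N T_R
  set La := sdeGenerator (P.langevinDrift N) vL vR a with hLa
  set Γ := carreDuChamp vL vR ρ ρ with hΓ
  have hYc : Continuous (P.langevinDrift N) := (P.contDiff_one_langevinDrift hU hV N).continuous
  have hFc : Continuous F := continuous_iff_continuousAt.2 fun u => (hF u).continuousAt
  have hF'c : Continuous F' := continuous_iff_continuousAt.2 fun u => (hF' u).continuousAt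
  have hρc : Continuous ρ := hρ.continuous
  have hΓc : Continuous Γ := continuous_carreDuChamp_of_contDiff vL vR hρ hρ
  have hLac : Continuous La := continuous_sdeGenerator _ _ hYc ha
  have hLasupp : HasCompactSupport La := hasCompactSupport_sdeGenerator _ _ hac
  have hK0 : 0 ≤ K := (abs_nonneg _).trans (hK 0)
  -- integrability
  have i1 : Integrable (fun x => La x * F (ρ x)) :=
    (hLac.mul (hFc.comp hρc)).integrable_of_hasCompactSupport hLasupp.mul_right
  have i2 : Integrable (fun x => a x * ((1 / 2) * F'' (ρ x) * Γ x)) :=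
    (ha.continuous.mul ((continuous_const.mul (hF''.comp hρc)).mul hΓc)).integrable_of_hasCompactSupport
      hac.mul_right
  have i3 : Integrable (fun x => a x * (2 * P.γ * (ρ x * F' (ρ x) - F (ρ x)))) :=
    (ha.continuous.mul (continuous_const.mul ((hρc.mul (hF'c.comp hρc)).sub (hFc.comp hρc)))).integrable_of_hasCompactSupport
      hac.mul_right
  -- the identity, rearranged
  have key := P.integral_generator_mul_comp_eq hU hV hN T_L T_R hρ hpde hF hF' hF'' ha hac
  have e1 : (fun x => a x * ((1 / 2) * F'' (ρ x) * Γ x - 2 * P.γ * (ρ x * F' (ρ x) - F (ρ x)))) =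
      fun x => a x * ((1 / 2) * F'' (ρ x) * Γ x) - a x * (2 * P.γ * (ρ x * F' (ρ x) - F (ρ x))) := by
    funext x; ring
  rw [e1, integral_sub i2 i3] at key
  have e2 : (1 / 2) * ∫ x, a x * (F'' (ρ x) * Γ x) = ∫ x, a x * ((1 / 2) * F'' (ρ x) * Γ x) := by
    rw [← integral_const_mul]
    refine integral_congr_ae (Eventually.of_forall fun x => ?_)
    ring
  rw [e2]
  have h12 : ∫ x, a x * ((1 / 2) * F'' (ρ x) * Γ x) =
      (∫ x, La x * F (ρ x)) + ∫ x, a x * (2 * P.γ * (ρ x * F' (ρ x) - F (ρ x))) := by linarith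
  rw [h12]
  -- bound the two terms
  have hb1 : ∫ x, La x * F (ρ x) ≤ ∫ x, K * (ℓ * θ (ρ x)) := by
    refine integral_mono i1 ((hθint.const_mul ℓ).const_mul K) fun x => ?_
    have hFx0 := hF0 _ (hρ0 x)
    have hFx := hFθ _ (hρ0 x)
    calc La x * F (ρ x) ≤ |La x| * F (ρ x) :=
          mul_le_mul_of_nonneg_right (le_abs_self _) hFx0
      _ ≤ K * (ℓ * θ (ρ x)) := mul_le_mul (hK x) hFx hFx0 hK0
  have hb2 : ∫ x, a x * (2 * P.γ * (ρ x * F' (ρ x) - F (ρ x))) ≤ ∫ x, 2 * P.γ * (ℓ * θ (ρ x)) := by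
    refine integral_mono i3 ((hθint.const_mul ℓ).const_mul (2 * P.γ)) fun x => ?_
    have hGx0 := hG0 _ (hρ0 x)
    have hGx := hGθ _ (hρ0 x)
    have h2γ : 0 ≤ 2 * P.γ := by linarith
    calc a x * (2 * P.γ * (ρ x * F' (ρ x) - F (ρ x))) ≤ 1 * (2 * P.γ * (ρ x * F' (ρ x) - F (ρ x))) :=
          mul_le_mul_of_nonneg_right (ha1 x) (mul_nonneg h2γ hGx0)
      _ ≤ 2 * P.γ * (ℓ * θ (ρ x)) := by rw [one_mul]; exact mul_le_mul_of_nonneg_left hGx h2γ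
  rw [integral_const_mul, integral_const_mul] at hb1
  rw [integral_const_mul, integral_const_mul] at hb2
  have : K * (ℓ * ∫ x, θ (ρ x)) + 2 * P.γ * (ℓ * ∫ x, θ (ρ x)) = ℓ * (K + 2 * P.γ) * ∫ x, θ (ρ x) := by
    ring
  linarith

end SiteChain

end Literature.MathematicalPhysics.KineticTheory.HeatConduction
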